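import Summits.BirchSwinnertonDyer.BirchSwinnertonDyer.Theorems.ByReductionTypeAtTwoAdditivePotGoodTorsionSlotsDecided
import Summits.BirchSwinnertonDyer.BirchSwinnertonDyer.Theorems.ByReductionTypeAtTwoAdditiveReducibleRestSiblingInstancesB
import Summits.BirchSwinnertonDyer.BirchSwinnertonDyer.Theorems.ByReductionTypeAtTwoAdditiveReducibleRestMemberInstancesA
import Literature.NumberTheory.EllipticCurves.PointCountEulerCriterion
import Literature.NumberTheory.EllipticCurves.AnomalousOfRationalTorsionProofs
import HarnessLib

/-!
# K4 crux `AdditiveRankZeroAtTwo` (19098), child C2″ `AdditivePotGoodReducibleRestAtTwo` (22616): the LAST displayed torsion slots of this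
# seat's instance stamps, DECIDED — the two `ℤ/4`-rows `303576s3` (K2 rep of class 303576s) and `362376g1` (class 362376g):
# `#E(ℚ)[2] = 2`, `#E(ℚ)[4] = #E(ℚ)[8] = … = 4`, by one rational root of the `2`-division cubic, an EXPLICIT rational point `P`
# with `2P = (e, 0)` (Mathlib's duplication formulas evaluated by `norm_num`), and «no rational point of order `8`» from a
# kernel-evaluated point count `#Ẽ(𝔽_ℓ)` with `8 ∤ #Ẽ(𝔽_ℓ)` at a good odd prime (`ℓ = 5`, `19`)

Cell `bsd-2adic`, seat `bsd-2adic-k4-w2` GEN 2 (prover, explicit unit, no kit); `--supports stmt-BirchSwinnertonDyer-22616 --as helper`; sequel of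
p664953 (`…TorsionSlotsDecided`, the eleven `[2]`-rows; its `natCard_torsionBy_two_of_unique_root` is reused) and of the stamps p663627
(`…SiblingInstancesB`, row 303576s: hypotheses `ht, ht₁, ht₂ = (2¹, 2², 2²)` at `303576s3`) / p663908 (`…MemberInstancesA`, row 362376g: the same
at `362376g1`). After this file EVERY torsion count displayed in this seat's C2″/C3″ stamps is a kernel theorem (`card_torsionBy_two_pow_add_two_<L> 0 / 1`
give the level-`4` and level-`8` slots; the level-`2` slot is `natCard_torsionBy_two_of_unique_root` as used inside), so the stamps' undecided inputs are
exactly: Selmer counts (instrument tier), `#Ш_an` and `r_an` (analytic record), and PRINT by name. THEOREMS ONLY.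

HONEST FRAMING: kernel theorems about two explicit curves; nothing booked; the `∀`-items C2″/C3″ stay OPEN; BSD is not proved by any of this.

METHOD. §0 `natCard_torsionBy_two_pow_of_halvingPoint`: `#E(ℚ)[2] = 2` (`E(ℚ)[2] = {O, T}`), `2P = T`, and no point of order `8` ⟹
`E(ℚ)[4] = {O, T, P, P + T}` has `4` elements and `E(ℚ)[2^(j+2)] = E(ℚ)[4]` (a point killed by `2^(j+3)` has `8 •` it `= O` by induction, and its
order is not `8`). §1 per curve: the root/non-residue certificate for `#E(ℚ)[2] = 2`; `P = (−19316, 231852)` resp. `(20402, 524151)` with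
`2P = (38647, 0)` resp. `(18245, 0)` (slopes `−4`, `243`); `#Ẽ(𝔽₅)(303576s3) = 4`, `#Ẽ(𝔽₁₉)(362376g1) = 28` by the tree's Euler-criterion column count
(`card_sol_eq_sum_euler`, `decide +kernel`) and `addOrderOf_dvd_reductionPointCount` (torsion injects mod a good odd prime, Silverman VII.3.1 (b)).

References: [SilvermanAEC2009] III.2.3 (d), VII.3.1 (b), VIII.7; [Knapp1993] Thm. 4.2; [IrelandRosen1990] Prop. 5.1.2; [CremonaAlgorithms1997] Table 1
(torsion structures `[4]` of 303576s3, 362376g1).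
-/

set_option autoImplicit false
-- the Theorems namespace of this sub repeats the summit name by design (D-0017 nested layout)
set_option linter.dupNamespace false

noncomputable section

open scoped Classical

open WeierstrassCurve Literature.NumberTheory.EllipticCurves
  Literature.NumberTheory.EllipticCurves.Rank1Residual Literature.NumberTheory.EllipticCurves.Rank1Residual.Typed
  Summit.BirchSwinnertonDyer.Rank1Residual
  Summit.BirchSwinnertonDyer.Rank1Residual.X5.O1
  Summit.BirchSwinnertonDyer.BirchSwinnertonDyer.Rank1Residual.IntModel

namespace Summit.BirchSwinnertonDyer.BirchSwinnertonDyer.Theorems.AddPotGoodInstances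

/-! ## §0 Torsion slots at a `ℤ/4`-row: `#E(ℚ)[2] = 2`, a halving point `2P = T`, and no point of order `8` -/

/-- **Torsion slots at a `ℤ/4`-row**: if `#E(ℚ)[2] = 2` (so `E(ℚ)[2] = {O, T}`), `2P = T` for a rational `P`, and `E(ℚ)` has no point of
order `8`, then `#E(ℚ)[4] = 4` (`E(ℚ)[4] = {O, T, P, P + T}`) and `#E(ℚ)[2^(j+2)] = 4` for every `j` (a point killed by `2^(j+3)` has its
double in `E(ℚ)[2^(j+2)] = E(ℚ)[4]`, so it is killed by `8`, and its order is not `8`). [folklore] -/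
theorem natCard_torsionBy_two_pow_of_halvingPoint (W : WeierstrassCurve ℚ) [W.IsElliptic]
    (h2 : Nat.card (AddSubgroup.torsionBy W.toAffine.Point 2) = 2 ^ 1) {T P : W.toAffine.Point} (hT0 : T ≠ 0)
    (hT2 : (2 : ℕ) • T = 0) (hP : (2 : ℕ) • P = T) (h8 : ∀ Q : W.toAffine.Point, addOrderOf Q ≠ 8) (j : ℕ) :
    Nat.card (AddSubgroup.torsionBy W.toAffine.Point ((2 ^ (j + 2) : ℕ) : ℤ)) = 2 ^ 2 := by
  have hmem : ∀ (n : ℕ) (Q : W.toAffine.Point), Q ∈ AddSubgroup.torsionBy W.toAffine.Point (n : ℤ) ↔ n • Q = 0 :=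
    fun n Q ↦ AddSubgroup.torsionBy.nsmul_iff
  -- `E(ℚ)[2] = {O, T}`
  have htwo : ∀ Q : W.toAffine.Point, (2 : ℕ) • Q = 0 → Q = 0 ∨ Q = T := by
    intro Q hQ
    by_contra h
    obtain ⟨hQ0, hQT⟩ := not_or.mp h
    obtain ⟨y, -, hy⟩ := (Nat.card_eq_two_iff'
      (⟨0, AddSubgroup.zero_mem _⟩ : AddSubgroup.torsionBy W.toAffine.Point 2)).mp (by rw [h2, pow_one])
    have hyQ := hy ⟨Q, (hmem 2 Q).mpr hQ⟩ (fun hq ↦ hQ0 (congrArg Subtype.val hq))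
    have hyT := hy ⟨T, (hmem 2 T).mpr hT2⟩ (fun hq ↦ hT0 (congrArg Subtype.val hq))
    exact hQT (congrArg Subtype.val (hyQ.trans hyT.symm))
  -- no order `8` ⟹ `8 • Q = 0 → 4 • Q = 0`
  have h84 : ∀ Q : W.toAffine.Point, (8 : ℕ) • Q = 0 → (4 : ℕ) • Q = 0 := by
    intro Q hQ
    have hdvd : addOrderOf Q ∣ 2 ^ 3 := addOrderOf_dvd_of_nsmul_eq_zero (by simpa using hQ)
    obtain ⟨i, hi, hord⟩ := (Nat.dvd_prime_pow Nat.prime_two).mp hdvd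
    have hi3 : i ≠ 3 := by rintro rfl; exact h8 Q (by rw [hord]; norm_num)
    have hdvd4 : addOrderOf Q ∣ 4 := by
      rw [hord, show (4 : ℕ) = 2 ^ 2 by norm_num]
      exact Nat.pow_dvd_pow 2 (by omega)
    exact addOrderOf_dvd_iff_nsmul_eq_zero.mp hdvd4
  -- by induction: `2^(k+2) • Q = 0 → 4 • Q = 0`
  have hk : ∀ (k : ℕ) (Q : W.toAffine.Point), 2 ^ (k + 2) • Q = 0 → (4 : ℕ) • Q = 0 := by
    intro k
    induction k with
    | zero => intro Q hQ; simpa using hQ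
    | succ k ih =>
        intro Q hQ
        have h' : 2 ^ (k + 2) • ((2 : ℕ) • Q) = 0 := by rw [smul_smul, ← pow_succ]; exact hQ
        have h8Q : (8 : ℕ) • Q = 0 := by
          have := ih _ h'
          rw [smul_smul] at this
          simpa using this
        exact h84 Q h8Q
  -- `E(ℚ)[2^(j+2)] = E(ℚ)[4]` as subgroups
  have heq : AddSubgroup.torsionBy W.toAffine.Point ((2 ^ (j + 2) : ℕ) : ℤ) = AddSubgroup.torsionBy W.toAffine.Point ((4 : ℕ) : ℤ) := by
    ext Q
    rw [hmem, hmem]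
    constructor
    · exact hk j Q
    · intro h
      rw [pow_succ, pow_succ, mul_assoc, show (2 : ℕ) * 2 = 4 by norm_num, ← smul_smul, h, nsmul_zero]
  rw [heq]
  -- `E(ℚ)[4] = {O, T, P, P + T}`
  have hP0 : P ≠ 0 := by rintro rfl; exact hT0 (by rw [← hP, nsmul_zero])
  have hPT : P ≠ T := by rintro rfl; exact hT0 (by rw [← hP]; exact hT2)
  have hPT0 : P + T ≠ 0 := by
    intro h
    have : P = -T := eq_neg_of_add_eq_zero_left h
    have hTT : -T = T := by
      rw [neg_eq_iff_add_eq_zero, ← two_nsmul]; exact hT2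
    rw [hTT] at this; exact hPT this
  have hPTT : P + T ≠ T := by intro h; exact hP0 (by simpa using h)
  have hPTP : P + T ≠ P := by intro h; exact hT0 (by simpa using h)
  have hset : ((AddSubgroup.torsionBy W.toAffine.Point ((4 : ℕ) : ℤ) : AddSubgroup W.toAffine.Point) : Set W.toAffine.Point)
      = {0, T, P, P + T} := by
    ext Q
    simp only [SetLike.mem_coe, Set.mem_insert_iff, Set.mem_singleton_iff]
    rw [hmem]
    constructor
    · intro h4
      have h22 : (2 : ℕ) • ((2 : ℕ) • Q) = 0 := by rw [smul_smul]; simpa using h4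
      rcases htwo _ h22 with h0 | hT'
      · rcases htwo _ h0 with h | h
        · exact Or.inl h
        · exact Or.inr (Or.inl h)
      · -- `2Q = T = 2P`, so `Q - P ∈ E[2]`
        have hQP : (2 : ℕ) • (Q - P) = 0 := by rw [nsmul_sub, hT', hP, sub_self]
        rcases htwo _ hQP with h | h
        · exact Or.inr (Or.inr (Or.inl (sub_eq_zero.mp h)))
        · exact Or.inr (Or.inr (Or.inr (by rw [add_comm]; exact sub_eq_iff_eq_add.mp h)))
    · rintro (rfl | rfl | rfl | rfl)
      · simp
      · rw [show (4 : ℕ) = 2 * 2 by norm_num, ← smul_smul, hT2, nsmul_zero]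
      · rw [show (4 : ℕ) = 2 * 2 by norm_num, ← smul_smul, hP]; exact hT2
      · rw [nsmul_add, show (4 : ℕ) = 2 * 2 by norm_num, ← smul_smul, ← smul_smul, hP, hT2, nsmul_zero, add_zero]
  rw [← SetLike.coe_sort_coe, Nat.card_coe_set_eq, hset, Set.ncard_insert_of_notMem (by simp [hT0.symm, hP0.symm, hPT0.symm]) (Set.toFinite _),
    Set.ncard_insert_of_notMem (by simp [Ne.symm hPT, Ne.symm hPTT]) (Set.toFinite _), Set.ncard_pair (Ne.symm hPTP)]
  norm_num

/-! ## §1 The two `ℤ/4`-rows of this seat's stamps: `303576s3`, `362376g1` -/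

/-- `#Ẽ(𝔽_5) = 4` for `303576s3` (Euler-criterion column count, kernel-evaluated; `5 ∤ Δ`). [folklore] -/
theorem numPoints_mod5_303576s3 :
    Nat.card (((⟨0, 1, 0, -1121139752, -14395601861088⟩ : WeierstrassCurve ℤ)).map (Int.castRingHom (ZMod 5))).toAffine.Point = 4 := by
  rw [@WeierstrassCurve.natCard_point_eq_one_add_card (ZMod 5) (@ZMod.instField 5 ⟨by norm_num⟩) _ _ _
    (by decide +kernel), @card_sol_eq_sum_euler (ZMod 5) (@ZMod.instField 5 ⟨by norm_num⟩) _ _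
    (by rw [ZMod.ringChar_zmod_n]; decide), ZMod.card]
  decide +kernel

/-- **Torsion slots of `303576s3`, decided** (`#E(ℚ)[2] = 2`, `#E(ℚ)[2^(j+2)] = 4`; Cremona `[4]`): one rational root `e = 38647` of the `2`-division cubic
(`(A, B) = (38648, 372489504)`, `A² − 4B = 3709888` non-square); the rational point `P = (-19316, 231852)` has `2P = (e, 0)` (Mathlib's duplication, kernel-evaluated);
and no rational point has order `8`, since `8 ∤ #Ẽ(𝔽_5) = 4` (`5` a good odd prime; tree `addOrderOf_dvd_reductionPointCount`).
[cite: SilvermanAEC2009, III.2.3 (d), VII.3.1 (b)] -/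
theorem card_torsionBy_two_pow_add_two_303576s3 (j : ℕ) :
    Nat.card (AddSubgroup.torsionBy (⟨0, 1, 0, -1121139752, -14395601861088⟩ : WeierstrassCurve ℚ).toAffine.Point ((2 ^ (j + 2) : ℕ) : ℤ)) = 2 ^ 2 := by
  haveI := isElliptic_303576s3; haveI := isGloballyMinimal_303576s3
  haveI : Fact (Nat.Prime 5) := ⟨by norm_num⟩
  have hns : (⟨0, 1, 0, -1121139752, -14395601861088⟩ : WeierstrassCurve ℚ).toAffine.Nonsingular 38647 0 :=
    (WeierstrassCurve.Affine.equation_iff_nonsingular).mp (by rw [WeierstrassCurve.Affine.equation_iff]; norm_num)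
  have hP4 : (⟨0, 1, 0, -1121139752, -14395601861088⟩ : WeierstrassCurve ℚ).toAffine.Nonsingular (-19316) 231852 :=
    (WeierstrassCurve.Affine.equation_iff_nonsingular).mp (by rw [WeierstrassCurve.Affine.equation_iff]; norm_num)
  refine natCard_torsionBy_two_pow_of_halvingPoint _ ?_ (T := Affine.Point.some 38647 0 hns)
    (P := Affine.Point.some (-19316) 231852 hP4) (Affine.Point.some_ne_zero hns) ?_ ?_ ?_ j
  · exact natCard_torsionBy_two_of_unique_root _ 38647 38648 372489504
      (by rw [show (38648 : ℚ) ^ 2 - 4 * 372489504 = ((3709888 : ℤ) : ℚ) by norm_num]; exact not_isSquare_intCast_of_forall_mul_self_ne (ℓ := 5) (by decide))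
      (by intro x; norm_num [WeierstrassCurve.b₂, WeierstrassCurve.b₄, WeierstrassCurve.b₆]; ring)
  · rw [two_nsmul]; exact Affine.Point.add_self_of_Y_eq (by norm_num [WeierstrassCurve.Affine.negY])
  · have hy : (231852 : ℚ) ≠ (⟨0, 1, 0, -1121139752, -14395601861088⟩ : WeierstrassCurve ℚ).toAffine.negY (-19316) 231852 := by
      norm_num [WeierstrassCurve.Affine.negY]
    rw [two_nsmul, Affine.Point.add_self_of_Y_ne hy, Affine.Point.some.injEq, WeierstrassCurve.Affine.slope_of_Y_ne rfl hy]
    constructor <;> norm_num [WeierstrassCurve.Affine.addX, WeierstrassCurve.Affine.addY, WeierstrassCurve.Affine.negAddY,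
      WeierstrassCurve.Affine.negY]
  · intro Q hQ
    have hfin : IsOfFinAddOrder Q := addOrderOf_pos_iff.mp (by rw [hQ]; norm_num)
    have hI : integralModelInt (⟨0, 1, 0, -1121139752, -14395601861088⟩ : WeierstrassCurve ℚ) = ⟨0, 1, 0, -1121139752, -14395601861088⟩ :=
      integralModelInt_eq_of_map_eq _ (by ext <;> simp [WeierstrassCurve.map])
    have hΔ : ¬ ((5 : ℕ) : ℤ) ∣ minimalDiscriminantInt (⟨0, 1, 0, -1121139752, -14395601861088⟩ : WeierstrassCurve ℚ) := by
      rw [minimalDiscriminantInt, hI]; decide +kernel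
    have hdvd := addOrderOf_dvd_reductionPointCount (⟨0, 1, 0, -1121139752, -14395601861088⟩ : WeierstrassCurve ℚ) 5 (by norm_num) hΔ hfin
    rw [hQ, reductionPointCount, hI, numPoints_mod5_303576s3] at hdvd
    norm_num at hdvd

/-- `#Ẽ(𝔽_19) = 28` for `362376g1` (Euler-criterion column count, kernel-evaluated; `19 ∤ Δ`). [folklore] -/
theorem numPoints_mod19_362376g1 :
    Nat.card (((⟨0, 0, 0, -993987426, 12061904531245⟩ : WeierstrassCurve ℤ)).map (Int.castRingHom (ZMod 19))).toAffine.Point = 28 := by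
  rw [@WeierstrassCurve.natCard_point_eq_one_add_card (ZMod 19) (@ZMod.instField 19 ⟨by norm_num⟩) _ _ _
    (by decide +kernel), @card_sol_eq_sum_euler (ZMod 19) (@ZMod.instField 19 ⟨by norm_num⟩) _ _
    (by rw [ZMod.ringChar_zmod_n]; decide), ZMod.card]
  decide +kernel

/-- **Torsion slots of `362376g1`, decided** (`#E(ℚ)[2] = 2`, `#E(ℚ)[2^(j+2)] = 4`; Cremona `[4]`): one rational root `e = 18245` of the `2`-division cubic
(`(A, B) = (18245, -661107401)`, `A² − 4B = 2977309629` non-square); the rational point `P = (20402, 524151)` has `2P = (e, 0)` (Mathlib's duplication, kernel-evaluated);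
and no rational point has order `8`, since `8 ∤ #Ẽ(𝔽_19) = 28` (`19` a good odd prime; tree `addOrderOf_dvd_reductionPointCount`).
[cite: SilvermanAEC2009, III.2.3 (d), VII.3.1 (b)] -/
theorem card_torsionBy_two_pow_add_two_362376g1 (j : ℕ) :
    Nat.card (AddSubgroup.torsionBy (⟨0, 0, 0, -993987426, 12061904531245⟩ : WeierstrassCurve ℚ).toAffine.Point ((2 ^ (j + 2) : ℕ) : ℤ)) = 2 ^ 2 := by
  haveI := isElliptic_362376g1; haveI := isGloballyMinimal_362376g1
  haveI : Fact (Nat.Prime 19) := ⟨by norm_num⟩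
  have hns : (⟨0, 0, 0, -993987426, 12061904531245⟩ : WeierstrassCurve ℚ).toAffine.Nonsingular 18245 0 :=
    (WeierstrassCurve.Affine.equation_iff_nonsingular).mp (by rw [WeierstrassCurve.Affine.equation_iff]; norm_num)
  have hP4 : (⟨0, 0, 0, -993987426, 12061904531245⟩ : WeierstrassCurve ℚ).toAffine.Nonsingular 20402 524151 :=
    (WeierstrassCurve.Affine.equation_iff_nonsingular).mp (by rw [WeierstrassCurve.Affine.equation_iff]; norm_num)
  refine natCard_torsionBy_two_pow_of_halvingPoint _ ?_ (T := Affine.Point.some 18245 0 hns)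
    (P := Affine.Point.some 20402 524151 hP4) (Affine.Point.some_ne_zero hns) ?_ ?_ ?_ j
  · exact natCard_torsionBy_two_of_unique_root _ 18245 18245 (-661107401)
      (by rw [show (18245 : ℚ) ^ 2 - 4 * (-661107401) = ((2977309629 : ℤ) : ℚ) by norm_num]; exact not_isSquare_intCast_of_forall_mul_self_ne (ℓ := 11) (by decide))
      (by intro x; norm_num [WeierstrassCurve.b₂, WeierstrassCurve.b₄, WeierstrassCurve.b₆]; ring)
  · rw [two_nsmul]; exact Affine.Point.add_self_of_Y_eq (by norm_num [WeierstrassCurve.Affine.negY])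
  · have hy : (524151 : ℚ) ≠ (⟨0, 0, 0, -993987426, 12061904531245⟩ : WeierstrassCurve ℚ).toAffine.negY 20402 524151 := by
      norm_num [WeierstrassCurve.Affine.negY]
    rw [two_nsmul, Affine.Point.add_self_of_Y_ne hy, Affine.Point.some.injEq, WeierstrassCurve.Affine.slope_of_Y_ne rfl hy]
    constructor <;> norm_num [WeierstrassCurve.Affine.addX, WeierstrassCurve.Affine.addY, WeierstrassCurve.Affine.negAddY,
      WeierstrassCurve.Affine.negY]
  · intro Q hQ
    have hfin : IsOfFinAddOrder Q := addOrderOf_pos_iff.mp (by rw [hQ]; norm_num)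
    have hI : integralModelInt (⟨0, 0, 0, -993987426, 12061904531245⟩ : WeierstrassCurve ℚ) = ⟨0, 0, 0, -993987426, 12061904531245⟩ :=
      integralModelInt_eq_of_map_eq _ (by ext <;> simp [WeierstrassCurve.map])
    have hΔ : ¬ ((19 : ℕ) : ℤ) ∣ minimalDiscriminantInt (⟨0, 0, 0, -993987426, 12061904531245⟩ : WeierstrassCurve ℚ) := by
      rw [minimalDiscriminantInt, hI]; decide +kernel
    have hdvd := addOrderOf_dvd_reductionPointCount (⟨0, 0, 0, -993987426, 12061904531245⟩ : WeierstrassCurve ℚ) 19 (by norm_num) hΔ hfin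
    rw [hQ, reductionPointCount, hI, numPoints_mod19_362376g1] at hdvd
    norm_num at hdvd

end Summit.BirchSwinnertonDyer.BirchSwinnertonDyer.Theorems.AddPotGoodInstances

end
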